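import Literature.MathematicalPhysics.KineticTheory.LangevinChainHarris
import Literature.Probability.Process.SmallSets
import HarnessLib

/-!
# The pinned chain: the minorisation of CEHR Prop. 3.6 from transition densities and irreducibility

Trunk T-KINETIC (Literature/MathematicalPhysics/KineticTheory). Provefact unit for the named fact
`CuneoEckmannHairerReyBellet2018_thm213` (`LangevinSemigroup.lean`), continued from
`LangevinChainHarris.lean`, where Cuneo–Eckmann–Hairer–Rey-Bellet 2018, Theorem 2.13 for the
pinned chain was proved from the named facts H2 (`CuneoEckmannHairerReyBellet2018_H2`) and
Hörmander 1967 Thm 1.1 and from the minorisation statement of CEHR Prop. 3.6 taken as a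
hypothesis. Here that hypothesis is DERIVED (for the constructed transition semigroup
`pinnedChainSemigroup`, which is Feller) from the two printed statements its proof rests on,
using the abstract small-set theorem of `Literature/Probability/Process/SmallSets.lean`
(`Literature.Probability.Process.MarkovSemigroup.exists_smul_restrict_le_of_isCompact`):

* CEHR Prop. 3.2 (transition densities): "Assume H1. Then the transition kernel (2.3) can be
  written as `P_t(z, dz') = p_t(z, z') dz'`, where the map `(t, z, z') ↦ p_t(z, z')` is smooth on
  `(0,∞) × Ω × Ω`" — used only through CONTINUITY of an `ℝ≥0`-valued density (hypothesis `h32`);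
* CEHR Prop. 3.3 (irreducibility): "Assume H1. Then … for every non-empty open set `U ⊂ Ω` and
  all `z ∈ Ω`, we have `sup_{t>0} P_t(z, U) > 0`" (hypothesis `h33`).

H1 (Hörmander's bracket condition) holds for the pinned chain by Prop. 4.1
(`OscillatorChain.isBracketGenerating_hormanderFamily`); Prop. 3.2 is Hörmander's theorem for
`∂_t - L` and Prop. 3.3 the control/support argument of its printed proof — neither is in the
tree, so both enter as explicit hypotheses, stated for the constructed kernels
`OscillatorChain.transitionKernel` in the parameter range of the fact (no new named fact, D-0026).

* `pinnedChain_minorization_of_density_of_irreducible` — PROVED: Prop. 3.2 + Prop. 3.3 ⟹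
  Prop. 3.6 for the pinned chain (minorising measures `ε · Leb|_{U₀}` for a fixed nonempty open
  `U₀`).
* `CuneoEckmannHairerReyBellet2018_thm213_of_H2_of_density_of_irreducible_of_hormander` —
  PROVED: Theorem 2.13 from H2, Prop. 3.2 (continuous densities), Prop. 3.3 (irreducibility) and
  Hörmander's Thm 1.1.

## References

* N. Cuneo, J.-P. Eckmann, M. Hairer, L. Rey-Bellet, *Non-equilibrium steady states for networks
  of oscillators*, Electron. J. Probab. 23 (2018) no. 55 (arXiv:1712.09413): Props. 3.2, 3.3, 3.6,
  Thm 2.13.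
-/

noncomputable section

open MeasureTheory ProbabilityTheory Filter Topology Set
open scoped NNReal ENNReal BoundedContinuousFunction

namespace Literature.MathematicalPhysics.KineticTheory.HeatConduction

open Literature.Probability.Process OscillatorChain

variable {N : ℕ}

section Pinned

variable {ω₂ lam β γ : ℝ} (hω : 0 < ω₂) (hl : 0 ≤ lam) (hβ : 0 < β) (hγ : 0 < γ)
  (hN : 0 < N) {T_L T_R : ℝ} (hL : 0 < T_L) (hR : 0 < T_R)
include hω hl hβ hγ hN hL hR

/-- **CEHR Prop. 3.6 for the pinned chain from Prop. 3.2 (continuous transition densities) and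
Prop. 3.3 (irreducibility).** If the transition kernels `P_t(z, ·)` of the pinned chain have, for
`t > 0`, densities `p_t(z, ·)` with respect to Lebesgue measure with `(t, z, z') ↦ p_t(z, z')`
continuous on `(0, ∞) × Ω × Ω` (Prop. 3.2: "the transition kernel can be written as
`P_t(z, dz') = p_t(z, z')dz'`, where the map `(t, z, z') ↦ p_t(z, z')` is smooth on
`(0,∞) × Ω × Ω`"), and every nonempty open set is reached with positive probability from every
point (Prop. 3.3: "for every non-empty open set `U ⊂ Ω` and all `z ∈ Ω`, we have
`sup_{t>0} P_t(z, U) > 0`"), then every compact set is small for all large times (Prop. 3.6):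
for every compact `C` there is `t_C` such that for all `t ≥ t_C` some nonzero measure `ν`
satisfies `ν ≤ P_t(z, ·)` for all `z ∈ C`. The semigroup is Feller
(`continuous_act_pinnedChainSemigroup`), so the abstract small-set theorem applies with the
open-positive reference measure `volume`. [cite: CuneoEckmannHairerReyBellet2018, Prop 3.6] -/
theorem pinnedChain_minorization_of_density_of_irreducible
    (h32 : ∃ p : ℝ≥0 → PhaseSpace N → PhaseSpace N → ℝ≥0,
      ContinuousOn (fun q : ℝ≥0 × PhaseSpace N × PhaseSpace N => p q.1 q.2.1 q.2.2) {q | 0 < q.1} ∧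
      ∀ t : ℝ≥0, 0 < t → ∀ z : PhaseSpace N,
        (pinnedChain ω₂ lam β γ).transitionKernel N T_L T_R t z =
          (volume : Measure (PhaseSpace N)).withDensity fun y => p t z y)
    (h33 : ∀ (z : PhaseSpace N) (U : Set (PhaseSpace N)), IsOpen U → U.Nonempty →
      ∃ t : ℝ≥0, 0 < (pinnedChain ω₂ lam β γ).transitionKernel N T_L T_R t z U) :
    ∀ C : Set (PhaseSpace N), IsCompact C → ∃ t_C : ℝ≥0, ∀ t : ℝ≥0, t_C ≤ t →
      ∃ ν : Measure (PhaseSpace N), ν ≠ 0 ∧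
        ∀ z ∈ C, ν ≤ (pinnedChain ω₂ lam β γ).transitionKernel N T_L T_R t z := by
  set S := pinnedChainSemigroup hω hl hβ.le hγ.le hN hL.le hR.le with hS
  obtain ⟨p, hp, hdens⟩ := h32
  have hF : ∀ (t : ℝ≥0) (g : PhaseSpace N →ᵇ ℝ), Continuous fun x => ∫ y, g y ∂(S.kernel t x) :=
    continuous_act_pinnedChainSemigroup hω hl hβ.le hγ.le hN hL.le hR.le
  have hdens' : ∀ t : ℝ≥0, 0 < t → ∀ z : PhaseSpace N,
      S.kernel t z = (volume : Measure (PhaseSpace N)).withDensity fun y => p t z y := hdens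
  have h33' : ∀ (z : PhaseSpace N) (U : Set (PhaseSpace N)), IsOpen U → U.Nonempty →
      ∃ t : ℝ≥0, 0 < S.kernel t z U := h33
  obtain ⟨U₀, hU₀, hU₀ne, hsmall⟩ := MarkovSemigroup.exists_smul_restrict_le_of_isCompact
    S.kernel S.kernel_add hF h33' p hp hdens'
  intro C hC
  obtain ⟨t_C, ht_C⟩ := hsmall C hC
  refine ⟨t_C, fun t ht => ?_⟩
  obtain ⟨ε, hε, hle⟩ := ht_C t ht
  refine ⟨ε • (volume : Measure (PhaseSpace N)).restrict U₀, ?_, hle⟩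
  intro h0
  have h1 : (ε • (volume : Measure (PhaseSpace N)).restrict U₀) U₀ = 0 := by
    rw [h0, Measure.coe_zero, Pi.zero_apply]
  rw [Measure.smul_apply, Measure.restrict_apply hU₀.measurableSet, Set.inter_self,
    smul_eq_mul] at h1
  exact (ENNReal.mul_pos hε.ne' (hU₀.measure_pos volume hU₀ne).ne').ne' h1

end Pinned

/-- **Cuneo–Eckmann–Hairer–Rey-Bellet 2018, Theorem 2.13 for the pinned chain, from the named
facts H2 (CEHR Thm 5.1 / Rem 5.2) and Hörmander 1967 Thm 1.1, and the printed statements of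
CEHR Prop. 3.2 (continuous transition densities, hypothesis `h32`) and Prop. 3.3 (irreducibility,
hypothesis `h33`) for the transition kernels of the pinned chain** — combining
`pinnedChain_minorization_of_density_of_irreducible` (Prop. 3.6) with
`CuneoEckmannHairerReyBellet2018_thm213_of_H2_of_minorization_of_hormander`.
[cite: CuneoEckmannHairerReyBellet2018, Thm 2.13] -/
theorem CuneoEckmannHairerReyBellet2018_thm213_of_H2_of_density_of_irreducible_of_hormander
    (h2 : CuneoEckmannHairerReyBellet2018_H2)
    (h32 : ∀ ω₂ lam β γ : ℝ, 0 < ω₂ → 0 ≤ lam → 0 < β → 0 < γ →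
      ∀ (N : ℕ) (T_L T_R : ℝ), 0 < N → 0 < T_L → 0 < T_R →
        ∃ p : ℝ≥0 → PhaseSpace N → PhaseSpace N → ℝ≥0,
          ContinuousOn (fun q : ℝ≥0 × PhaseSpace N × PhaseSpace N => p q.1 q.2.1 q.2.2)
            {q | 0 < q.1} ∧
          ∀ t : ℝ≥0, 0 < t → ∀ z : PhaseSpace N,
            (pinnedChain ω₂ lam β γ).transitionKernel N T_L T_R t z =
              (volume : Measure (PhaseSpace N)).withDensity fun y => p t z y)
    (h33 : ∀ ω₂ lam β γ : ℝ, 0 < ω₂ → 0 ≤ lam → 0 < β → 0 < γ →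
      ∀ (N : ℕ) (T_L T_R : ℝ), 0 < N → 0 < T_L → 0 < T_R →
        ∀ (z : PhaseSpace N) (U : Set (PhaseSpace N)), IsOpen U → U.Nonempty →
          ∃ t : ℝ≥0, 0 < (pinnedChain ω₂ lam β γ).transitionKernel N T_L T_R t z U)
    (hH : Literature.Analysis.Distribution.Hormander1967_thm11) :
    CuneoEckmannHairerReyBellet2018_thm213 :=
  CuneoEckmannHairerReyBellet2018_thm213_of_H2_of_minorization_of_hormander h2
    (fun ω₂ lam β γ hω hl hβ hγ N T_L T_R hN hL hR =>
      pinnedChain_minorization_of_density_of_irreducible hω hl hβ hγ hN hL hR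
        (h32 ω₂ lam β γ hω hl hβ hγ N T_L T_R hN hL hR)
        (h33 ω₂ lam β γ hω hl hβ hγ N T_L T_R hN hL hR)) hH

end Literature.MathematicalPhysics.KineticTheory.HeatConduction
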